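import Summits.ValiantsHypothesis.ValiantsHypothesis.Theorems.RigidityForcesSymmetryGrenetFirstOrderRankRigidBlockIIMaster
import Summits.ValiantsHypothesis.ValiantsHypothesis.Theorems.RigidityForcesSymmetryGrenetFirstOrderRankRigidBlockIIExtraA
import Summits.ValiantsHypothesis.ValiantsHypothesis.Theorems.RigidityForcesSymmetryGrenetFirstOrderRankRigidBlockIIExtraB

/-!
# Route RigidityForcesSymmetry — `GrenetFirstOrderRankRigid` (item stmt-ValiantsHypothesis-21029),
line `grenet_gauge`: stub `stub_linearRigid`, step 5 (block II) — designs E2 and E3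

For the crux line `Cruxes/GrenetFirstOrderRankRigid/Lines/grenet_gauge.lean` (blueprint
`Lines/grenet_gauge-stub_linearRigid-PROOF.md`, §5, block II; NOTES "TYPE II FORMAL PLAN").
The master identity of the overlap block `(A, k₀)` (`grenet_blockII_master`) at the two extra-cell
design points gives, in terms of the tail-shaped entries `ρ[C', p]` and head-shaped entries `κ[C', p]`
of a tangent direction supported on the tail/head positions,

* E2 (`grenet_blockII_E2`): `Σ_{C'} ρ[C', αₐ] - ρ[C, φ] + Σ_{C'} κ[C', α₁] - κ[C, α₁] = 0`
  (`φ ∈ C`, `αₐ ∈ A`, `α₁` the auxiliary letter of the design);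
* E3 (`grenet_blockII_E3`): `Σ_{C'} ρ[C', αₐ] - ρ[C, αₐ] + Σ_{C'} κ[C', α₁] - κ[C, φ'] = 0`
  (`φ' ∉ A ∪ C`, `α₁ ∈ A`).

No new definitions.  VP ≠ VNP is not moved by this file.
-/

noncomputable section

open MvPolynomial Matrix Finset

namespace Summit.ValiantsHypothesis.Theorems.RigidityForcesSymmetry.GrenetGauge

open Literature.Computability.AlgebraicComplexity

variable {k : Type*} [CommRing k] [IsDomain k] {n N : ℕ} (e : Finset (Fin n) ≃ Fin (N + 1))

/-- **Design E2 of the overlap block `(A, k₀)`** (left-anchored extra cell; see `…BlockIIExtraA`):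
`Σ_{C'} ρ[C', αₐ] - ρ[C, φ] + Σ_{C'} κ[C', α₁] - κ[C, α₁] = 0`. [cite: Grenet2011, Thm. 1] -/
theorem grenet_blockII_E2 (hn : n ≠ 0) (hN : 2 ^ n = N + 1)
    (A' : Fin n × Fin n → Matrix (Fin N) (Fin N) k)
    (htr : ((Grenet.repr k n e).adjugate * ∑ v, (X v : MvPolynomial (Fin n × Fin n) k) • (A' v).map C).trace = 0)
    (hsupp : ∀ (w : Fin n × Fin n) (a b : Fin N), A' w a b ≠ 0 →
      (w.1 ∉ e.symm ((e univ).succAbove a) ∧ (w.2 : ℕ) = (e.symm ((e univ).succAbove a)).card) ∨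
      (w.1 ∈ e.symm ((e ∅).succAbove b) ∧ (e.symm ((e ∅).succAbove b)).card = (w.2 : ℕ) + 1))
    (A : Finset (Fin n)) (hA : 0 < A.card) (k₀ : ℕ) {u : ℕ} (huA : A.card + k₀ = u) (hu : u ≤ n)
    (hul : u - 1 < n) (hkn : k₀ < n) (C : Finset (Fin n)) (hCA : C ⊆ Aᶜ)
    (φ αₐ : Fin n) (hφ : φ ∈ C) (hαₐ : αₐ ∈ A) (π : Equiv.Perm (Fin n)) (c₁ : Fin n) (hc₁ : (c₁ : ℕ) < k₀)
    (hπc₁ : π c₁ = αₐ)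
    (hs1 : (univ.filter fun c : Fin n => (c : ℕ) < k₀).image π = insert αₐ (C.erase φ))
    (hs2 : (univ.filter fun c : Fin n => (c : ℕ) < u - 1).image π = (A ∪ C).erase φ)
    (hs3 : (univ.filter fun c : Fin n => (c : ℕ) < u).image π = A ∪ C)
    (α₁ : Fin n) (hα₁ : k₀ < u - 1 → α₁ = π ⟨k₀, hkn⟩) (hα₁' : u - 1 = k₀ → α₁ = αₐ) :
    (∑ x ∈ univ.filter (fun x : Fin N × Fin N × (Fin n × Fin n) => (x.2.2.1 ∉ e.symm ((e univ).succAbove x.1) ∧ e.symm ((e ∅).succAbove x.2.1) ⊆ Aᶜ ∧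
        (e.symm ((e ∅).succAbove x.2.1)).card = k₀ ∧
        insert x.2.2.1 (e.symm ((e univ).succAbove x.1)) = A ∪ e.symm ((e ∅).succAbove x.2.1) ∧ (x.2.2.2 : ℕ) = u - 1) ∧ x.2.2.1 = αₐ), A' x.2.2 x.1 x.2.1
      - ∑ x ∈ univ.filter (fun x : Fin N × Fin N × (Fin n × Fin n) => (x.2.2.1 ∉ e.symm ((e univ).succAbove x.1) ∧ e.symm ((e ∅).succAbove x.2.1) ⊆ Aᶜ ∧
        (e.symm ((e ∅).succAbove x.2.1)).card = k₀ ∧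
        insert x.2.2.1 (e.symm ((e univ).succAbove x.1)) = A ∪ e.symm ((e ∅).succAbove x.2.1) ∧ (x.2.2.2 : ℕ) = u - 1) ∧ (e.symm ((e ∅).succAbove x.2.1) = C ∧ x.2.2.1 = φ)),
          A' x.2.2 x.1 x.2.1)
    + (∑ x ∈ univ.filter (fun x : Fin N × Fin N × (Fin n × Fin n) => (x.2.2.1 ∈ e.symm ((e ∅).succAbove x.2.1) ∧ (e.symm ((e ∅).succAbove x.2.1)).erase x.2.2.1 ⊆ Aᶜ ∧
        ((e.symm ((e ∅).succAbove x.2.1)).erase x.2.2.1).card = k₀ ∧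
        e.symm ((e univ).succAbove x.1) = A ∪ (e.symm ((e ∅).succAbove x.2.1)).erase x.2.2.1 ∧ (x.2.2.2 : ℕ) = k₀) ∧ x.2.2.1 = α₁), A' x.2.2 x.1 x.2.1
      - ∑ x ∈ univ.filter (fun x : Fin N × Fin N × (Fin n × Fin n) => (x.2.2.1 ∈ e.symm ((e ∅).succAbove x.2.1) ∧ (e.symm ((e ∅).succAbove x.2.1)).erase x.2.2.1 ⊆ Aᶜ ∧
        ((e.symm ((e ∅).succAbove x.2.1)).erase x.2.2.1).card = k₀ ∧
        e.symm ((e univ).succAbove x.1) = A ∪ (e.symm ((e ∅).succAbove x.2.1)).erase x.2.2.1 ∧ (x.2.2.2 : ℕ) = k₀) ∧ ((e.symm ((e ∅).succAbove x.2.1)).erase x.2.2.1 = C ∧ x.2.2.1 = α₁)),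
          A' x.2.2 x.1 x.2.1) = 0 := by
  classical
  have hm := grenet_blockII_master e hn hN A' htr hsupp A hA k₀ huA hu (fun w : Fin n × Fin n => if π w.2 = w.1 ∨ (w.2 = (⟨u - 1, hul⟩ : Fin n) ∧ w.1 = π c₁) then (1 : k) else 0)
  have e1 : ∑ x ∈ univ.filter (fun x : Fin N × Fin N × (Fin n × Fin n) => (x.2.2.1 ∉ e.symm ((e univ).succAbove x.1) ∧ e.symm ((e ∅).succAbove x.2.1) ⊆ Aᶜ ∧
        (e.symm ((e ∅).succAbove x.2.1)).card = k₀ ∧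
        insert x.2.2.1 (e.symm ((e univ).succAbove x.1)) = A ∪ e.symm ((e ∅).succAbove x.2.1) ∧ (x.2.2.2 : ℕ) = u - 1)),
      A' x.2.2 x.1 x.2.1 * eval (fun w : Fin n × Fin n => if π w.2 = w.1 ∨ (w.2 = (⟨u - 1, hul⟩ : Fin n) ∧ w.1 = π c₁) then (1 : k) else 0) (perPoly (Fin n) k * (1 - Grenet.adj k n).adjugate (e.symm ((e ∅).succAbove x.2.1)) (e.symm ((e univ).succAbove x.1)) * X x.2.2
          - (1 - Grenet.adj k n).adjugate ∅ (e.symm ((e univ).succAbove x.1)) * X x.2.2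
            * (1 - Grenet.adj k n).adjugate (e.symm ((e ∅).succAbove x.2.1)) univ)
      = ∑ x ∈ univ.filter (fun x : Fin N × Fin N × (Fin n × Fin n) => (x.2.2.1 ∉ e.symm ((e univ).succAbove x.1) ∧ e.symm ((e ∅).succAbove x.2.1) ⊆ Aᶜ ∧
        (e.symm ((e ∅).succAbove x.2.1)).card = k₀ ∧
        insert x.2.2.1 (e.symm ((e univ).succAbove x.1)) = A ∪ e.symm ((e ∅).succAbove x.2.1) ∧ (x.2.2.2 : ℕ) = u - 1)),
        ((if x.2.2.1 = αₐ then A' x.2.2 x.1 x.2.1 else 0) - (if (e.symm ((e ∅).succAbove x.2.1) = C ∧ x.2.2.1 = φ) then A' x.2.2 x.1 x.2.1 else 0)) := by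
    refine Finset.sum_congr rfl fun x hx => ?_
    obtain ⟨h1, h2, h3, h4, h5⟩ := (Finset.mem_filter.mp hx).2
    have hdisj : Disjoint A (e.symm ((e ∅).succAbove x.2.1)) :=
      Finset.disjoint_left.mpr fun y hyA hyC => (Finset.mem_compl.mp (h2 hyC)) hyA
    have hScard : (e.symm ((e univ).succAbove x.1)).card = u - 1 := by
      have := congrArg Finset.card h4
      rw [Finset.card_insert_of_notMem h1, Finset.card_union_of_disjoint hdisj, h3] at this; omega
    rw [blockII_extraA_eval_tail k π A C k₀ huA hul hCA φ αₐ hφ hαₐ c₁ hc₁ hπc₁ hs1 hs2 hs3 (e.symm ((e univ).succAbove x.1)) (e.symm ((e ∅).succAbove x.2.1)) x.2.2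
      ⟨h1, by omega⟩ h2 h3 h4 h5, mul_sub, mul_ite, mul_ite, mul_one, mul_zero]
  have e2 : ∑ x ∈ univ.filter (fun x : Fin N × Fin N × (Fin n × Fin n) => (x.2.2.1 ∈ e.symm ((e ∅).succAbove x.2.1) ∧ (e.symm ((e ∅).succAbove x.2.1)).erase x.2.2.1 ⊆ Aᶜ ∧
        ((e.symm ((e ∅).succAbove x.2.1)).erase x.2.2.1).card = k₀ ∧
        e.symm ((e univ).succAbove x.1) = A ∪ (e.symm ((e ∅).succAbove x.2.1)).erase x.2.2.1 ∧ (x.2.2.2 : ℕ) = k₀)),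
      A' x.2.2 x.1 x.2.1 * eval (fun w : Fin n × Fin n => if π w.2 = w.1 ∨ (w.2 = (⟨u - 1, hul⟩ : Fin n) ∧ w.1 = π c₁) then (1 : k) else 0) (perPoly (Fin n) k * (1 - Grenet.adj k n).adjugate (e.symm ((e ∅).succAbove x.2.1)) (e.symm ((e univ).succAbove x.1)) * X x.2.2
          - (1 - Grenet.adj k n).adjugate ∅ (e.symm ((e univ).succAbove x.1)) * X x.2.2
            * (1 - Grenet.adj k n).adjugate (e.symm ((e ∅).succAbove x.2.1)) univ)
      = ∑ x ∈ univ.filter (fun x : Fin N × Fin N × (Fin n × Fin n) => (x.2.2.1 ∈ e.symm ((e ∅).succAbove x.2.1) ∧ (e.symm ((e ∅).succAbove x.2.1)).erase x.2.2.1 ⊆ Aᶜ ∧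
        ((e.symm ((e ∅).succAbove x.2.1)).erase x.2.2.1).card = k₀ ∧
        e.symm ((e univ).succAbove x.1) = A ∪ (e.symm ((e ∅).succAbove x.2.1)).erase x.2.2.1 ∧ (x.2.2.2 : ℕ) = k₀)),
        ((if x.2.2.1 = α₁ then A' x.2.2 x.1 x.2.1 else 0)
          - (if ((e.symm ((e ∅).succAbove x.2.1)).erase x.2.2.1 = C ∧ x.2.2.1 = α₁) then A' x.2.2 x.1 x.2.1 else 0)) := by
    refine Finset.sum_congr rfl fun x hx => ?_
    obtain ⟨h1, h2, h3, h4, h5⟩ := (Finset.mem_filter.mp hx).2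
    have hTcard : (e.symm ((e ∅).succAbove x.2.1)).card = (x.2.2.2 : ℕ) + 1 := by
      have := Finset.card_erase_of_mem h1
      have h' := Finset.card_pos.mpr ⟨_, h1⟩
      rw [h3] at this; omega
    rw [blockII_extraA_eval_head k π A C k₀ huA hul hkn hCA φ αₐ hφ hαₐ c₁ hc₁ hπc₁ hs1 hs2 hs3 (e.symm ((e univ).succAbove x.1)) (e.symm ((e ∅).succAbove x.2.1))
      x.2.2 ⟨h1, hTcard⟩ h2 h3 h4 h5 α₁ hα₁ hα₁', mul_sub, mul_ite, mul_ite, mul_one, mul_zero]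
  rw [e1, e2, Finset.sum_sub_distrib, Finset.sum_sub_distrib, ← Finset.sum_filter, ← Finset.sum_filter,
    ← Finset.sum_filter, ← Finset.sum_filter, Finset.filter_filter, Finset.filter_filter, Finset.filter_filter,
    Finset.filter_filter] at hm
  exact hm

/-- **Design E3 of the overlap block `(A, k₀)`** (right-anchored extra cell; see `…BlockIIExtraB`):
`Σ_{C'} ρ[C', αₐ] - ρ[C, αₐ] + Σ_{C'} κ[C', α₁] - κ[C, φ'] = 0`. [cite: Grenet2011, Thm. 1] -/
theorem grenet_blockII_E3 (hn : n ≠ 0) (hN : 2 ^ n = N + 1)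
    (A' : Fin n × Fin n → Matrix (Fin N) (Fin N) k)
    (htr : ((Grenet.repr k n e).adjugate * ∑ v, (X v : MvPolynomial (Fin n × Fin n) k) • (A' v).map C).trace = 0)
    (hsupp : ∀ (w : Fin n × Fin n) (a b : Fin N), A' w a b ≠ 0 →
      (w.1 ∉ e.symm ((e univ).succAbove a) ∧ (w.2 : ℕ) = (e.symm ((e univ).succAbove a)).card) ∨
      (w.1 ∈ e.symm ((e ∅).succAbove b) ∧ (e.symm ((e ∅).succAbove b)).card = (w.2 : ℕ) + 1))
    (A : Finset (Fin n)) (hA : 0 < A.card) (k₀ : ℕ) {u : ℕ} (huA : A.card + k₀ = u)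
    (hul : u - 1 < n) (hkn : k₀ < n) (hun : u < n) (C : Finset (Fin n)) (hCA : C ⊆ Aᶜ)
    (φ' α₁ : Fin n) (hφ'A : φ' ∉ A) (hφ'C : φ' ∉ C) (hα₁ : α₁ ∈ A) (π : Equiv.Perm (Fin n))
    (hπk : π ⟨k₀, hkn⟩ = φ') (hπu : π ⟨u, hun⟩ = α₁)
    (ht1 : (univ.filter fun c : Fin n => (c : ℕ) < k₀).image π = C)
    (ht2 : (univ.filter fun c : Fin n => (c : ℕ) < k₀ + 1).image π = insert φ' C)
    (ht3 : (univ.filter fun c : Fin n => (c : ℕ) < u).image π = insert φ' (C ∪ A.erase α₁))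
    (αₐ : Fin n) (hαₐ : k₀ < u - 1 → αₐ = π ⟨u - 1, hul⟩) (hαₐ' : u - 1 = k₀ → αₐ = α₁) :
    (∑ x ∈ univ.filter (fun x : Fin N × Fin N × (Fin n × Fin n) => (x.2.2.1 ∉ e.symm ((e univ).succAbove x.1) ∧ e.symm ((e ∅).succAbove x.2.1) ⊆ Aᶜ ∧
        (e.symm ((e ∅).succAbove x.2.1)).card = k₀ ∧
        insert x.2.2.1 (e.symm ((e univ).succAbove x.1)) = A ∪ e.symm ((e ∅).succAbove x.2.1) ∧ (x.2.2.2 : ℕ) = u - 1) ∧ x.2.2.1 = αₐ), A' x.2.2 x.1 x.2.1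
      - ∑ x ∈ univ.filter (fun x : Fin N × Fin N × (Fin n × Fin n) => (x.2.2.1 ∉ e.symm ((e univ).succAbove x.1) ∧ e.symm ((e ∅).succAbove x.2.1) ⊆ Aᶜ ∧
        (e.symm ((e ∅).succAbove x.2.1)).card = k₀ ∧
        insert x.2.2.1 (e.symm ((e univ).succAbove x.1)) = A ∪ e.symm ((e ∅).succAbove x.2.1) ∧ (x.2.2.2 : ℕ) = u - 1) ∧ (x.2.2.1 = αₐ ∧ e.symm ((e ∅).succAbove x.2.1) = C)),
          A' x.2.2 x.1 x.2.1)
    + (∑ x ∈ univ.filter (fun x : Fin N × Fin N × (Fin n × Fin n) => (x.2.2.1 ∈ e.symm ((e ∅).succAbove x.2.1) ∧ (e.symm ((e ∅).succAbove x.2.1)).erase x.2.2.1 ⊆ Aᶜ ∧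
        ((e.symm ((e ∅).succAbove x.2.1)).erase x.2.2.1).card = k₀ ∧
        e.symm ((e univ).succAbove x.1) = A ∪ (e.symm ((e ∅).succAbove x.2.1)).erase x.2.2.1 ∧ (x.2.2.2 : ℕ) = k₀) ∧ x.2.2.1 = α₁), A' x.2.2 x.1 x.2.1
      - ∑ x ∈ univ.filter (fun x : Fin N × Fin N × (Fin n × Fin n) => (x.2.2.1 ∈ e.symm ((e ∅).succAbove x.2.1) ∧ (e.symm ((e ∅).succAbove x.2.1)).erase x.2.2.1 ⊆ Aᶜ ∧
        ((e.symm ((e ∅).succAbove x.2.1)).erase x.2.2.1).card = k₀ ∧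
        e.symm ((e univ).succAbove x.1) = A ∪ (e.symm ((e ∅).succAbove x.2.1)).erase x.2.2.1 ∧ (x.2.2.2 : ℕ) = k₀) ∧ ((e.symm ((e ∅).succAbove x.2.1)).erase x.2.2.1 = C ∧ x.2.2.1 = φ')),
          A' x.2.2 x.1 x.2.1) = 0 := by
  classical
  have hm := grenet_blockII_master e hn hN A' htr hsupp A hA k₀ huA hun.le (fun w : Fin n × Fin n => if π w.2 = w.1 ∨ (w.2 = (⟨k₀, hkn⟩ : Fin n) ∧ w.1 = π ⟨u, hun⟩) then (1 : k) else 0)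
  have e1 : ∑ x ∈ univ.filter (fun x : Fin N × Fin N × (Fin n × Fin n) => (x.2.2.1 ∉ e.symm ((e univ).succAbove x.1) ∧ e.symm ((e ∅).succAbove x.2.1) ⊆ Aᶜ ∧
        (e.symm ((e ∅).succAbove x.2.1)).card = k₀ ∧
        insert x.2.2.1 (e.symm ((e univ).succAbove x.1)) = A ∪ e.symm ((e ∅).succAbove x.2.1) ∧ (x.2.2.2 : ℕ) = u - 1)),
      A' x.2.2 x.1 x.2.1 * eval (fun w : Fin n × Fin n => if π w.2 = w.1 ∨ (w.2 = (⟨k₀, hkn⟩ : Fin n) ∧ w.1 = π ⟨u, hun⟩) then (1 : k) else 0) (perPoly (Fin n) k * (1 - Grenet.adj k n).adjugate (e.symm ((e ∅).succAbove x.2.1)) (e.symm ((e univ).succAbove x.1)) * X x.2.2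
          - (1 - Grenet.adj k n).adjugate ∅ (e.symm ((e univ).succAbove x.1)) * X x.2.2
            * (1 - Grenet.adj k n).adjugate (e.symm ((e ∅).succAbove x.2.1)) univ)
      = ∑ x ∈ univ.filter (fun x : Fin N × Fin N × (Fin n × Fin n) => (x.2.2.1 ∉ e.symm ((e univ).succAbove x.1) ∧ e.symm ((e ∅).succAbove x.2.1) ⊆ Aᶜ ∧
        (e.symm ((e ∅).succAbove x.2.1)).card = k₀ ∧
        insert x.2.2.1 (e.symm ((e univ).succAbove x.1)) = A ∪ e.symm ((e ∅).succAbove x.2.1) ∧ (x.2.2.2 : ℕ) = u - 1)),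
        ((if x.2.2.1 = αₐ then A' x.2.2 x.1 x.2.1 else 0) - (if (x.2.2.1 = αₐ ∧ e.symm ((e ∅).succAbove x.2.1) = C) then A' x.2.2 x.1 x.2.1 else 0)) := by
    refine Finset.sum_congr rfl fun x hx => ?_
    obtain ⟨h1, h2, h3, h4, h5⟩ := (Finset.mem_filter.mp hx).2
    have hdisj : Disjoint A (e.symm ((e ∅).succAbove x.2.1)) :=
      Finset.disjoint_left.mpr fun y hyA hyC => (Finset.mem_compl.mp (h2 hyC)) hyA
    have hScard : (e.symm ((e univ).succAbove x.1)).card = u - 1 := by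
      have := congrArg Finset.card h4
      rw [Finset.card_insert_of_notMem h1, Finset.card_union_of_disjoint hdisj, h3] at this; omega
    rw [blockII_extraB_eval_tail k π A C k₀ huA hul hkn hun hCA φ' α₁ hφ'A hφ'C hα₁ hπk hπu ht1 ht2 ht3
      (e.symm ((e univ).succAbove x.1)) (e.symm ((e ∅).succAbove x.2.1)) x.2.2 ⟨h1, by omega⟩ h2 h3 h4 h5 αₐ hαₐ hαₐ', mul_sub, mul_ite, mul_ite, mul_one, mul_zero]
  have e2 : ∑ x ∈ univ.filter (fun x : Fin N × Fin N × (Fin n × Fin n) => (x.2.2.1 ∈ e.symm ((e ∅).succAbove x.2.1) ∧ (e.symm ((e ∅).succAbove x.2.1)).erase x.2.2.1 ⊆ Aᶜ ∧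
        ((e.symm ((e ∅).succAbove x.2.1)).erase x.2.2.1).card = k₀ ∧
        e.symm ((e univ).succAbove x.1) = A ∪ (e.symm ((e ∅).succAbove x.2.1)).erase x.2.2.1 ∧ (x.2.2.2 : ℕ) = k₀)),
      A' x.2.2 x.1 x.2.1 * eval (fun w : Fin n × Fin n => if π w.2 = w.1 ∨ (w.2 = (⟨k₀, hkn⟩ : Fin n) ∧ w.1 = π ⟨u, hun⟩) then (1 : k) else 0) (perPoly (Fin n) k * (1 - Grenet.adj k n).adjugate (e.symm ((e ∅).succAbove x.2.1)) (e.symm ((e univ).succAbove x.1)) * X x.2.2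
          - (1 - Grenet.adj k n).adjugate ∅ (e.symm ((e univ).succAbove x.1)) * X x.2.2
            * (1 - Grenet.adj k n).adjugate (e.symm ((e ∅).succAbove x.2.1)) univ)
      = ∑ x ∈ univ.filter (fun x : Fin N × Fin N × (Fin n × Fin n) => (x.2.2.1 ∈ e.symm ((e ∅).succAbove x.2.1) ∧ (e.symm ((e ∅).succAbove x.2.1)).erase x.2.2.1 ⊆ Aᶜ ∧
        ((e.symm ((e ∅).succAbove x.2.1)).erase x.2.2.1).card = k₀ ∧
        e.symm ((e univ).succAbove x.1) = A ∪ (e.symm ((e ∅).succAbove x.2.1)).erase x.2.2.1 ∧ (x.2.2.2 : ℕ) = k₀)),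
        ((if x.2.2.1 = α₁ then A' x.2.2 x.1 x.2.1 else 0)
          - (if ((e.symm ((e ∅).succAbove x.2.1)).erase x.2.2.1 = C ∧ x.2.2.1 = φ') then A' x.2.2 x.1 x.2.1 else 0)) := by
    refine Finset.sum_congr rfl fun x hx => ?_
    obtain ⟨h1, h2, h3, h4, h5⟩ := (Finset.mem_filter.mp hx).2
    have hTcard : (e.symm ((e ∅).succAbove x.2.1)).card = (x.2.2.2 : ℕ) + 1 := by
      have := Finset.card_erase_of_mem h1
      have h' := Finset.card_pos.mpr ⟨_, h1⟩
      rw [h3] at this; omega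
    rw [blockII_extraB_eval_head k π A C k₀ huA hkn hun hCA φ' α₁ hφ'A hφ'C hα₁ hπk hπu ht2 ht3 (e.symm ((e univ).succAbove x.1)) (e.symm ((e ∅).succAbove x.2.1))
      x.2.2 ⟨h1, hTcard⟩ h2 h3 h4 h5, mul_sub, mul_ite, mul_ite, mul_one, mul_zero]
  rw [e1, e2, Finset.sum_sub_distrib, Finset.sum_sub_distrib, ← Finset.sum_filter, ← Finset.sum_filter,
    ← Finset.sum_filter, ← Finset.sum_filter, Finset.filter_filter, Finset.filter_filter, Finset.filter_filter,
    Finset.filter_filter] at hm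
  exact hm

end Summit.ValiantsHypothesis.Theorems.RigidityForcesSymmetry.GrenetGauge
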